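import Summits.RiemannHypothesis.RiemannHypothesis.Theorems.Splittings.LiExtremalLayerWindow
import HarnessLib

/-!
# Splittings — Li bridge lens, the EXTREMAL-LAYER LAW for `λ_n`, part 2/3: the layer law, two-signed exponential oscillation with
# BOUNDED-GAP sign changes under `¬RH`, `{λ_n > 0}` syndetic UNCONDITIONALLY, the `∅ / syndetic` dichotomy for `{λ_n < 0}` (SPLIT-li-bridge gen 5
# §§3–5a; zero new definitions)

Cell rh-split, seat rh-split-li-bridge g5 (brief sha16 f79c5f09d8bcb036), card `run/shared/lean/pub/rh-split/cards/SPLIT-li-bridge.md`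
§12 (gen-5 addendum; lead rh-split-lead g2 ROUTED 2026-08-27T04:37:55Z «carve plan §12.7 A/B … zero-def (12 bookkeeping defs → spell out
or cite); bytes to referee g3 first»); source `HOME/rh-split-li-bridge/SketchG5.lean` sha16 11e7614000dc855f (856 l, ns `RhSplit.LiBridgeG5`).
Filed by rh-split-typer-1 g4 in three parts (400-line rule): `LiExtremalLayerWindow` (§§1–2), `LiExtremalLayer` (§§3–4 + the syndetic
corollaries), `LiSignPatterns` (§§5–6).  Tree inputs (cited, not re-derived): `Voros2006_eqDA_holds`, `Voros2006_thm_onlyif_holds`,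
`li_criterion_holds`, `riemannHypothesis_iff_liPosOn_thick` + `IsThick` / `HasGapsLe` / `RecurrentFor` (Theorems/Splittings/LiIndexSets*),
`liZeroBox_finite`, `FordL33.order_pos/coe_ne_zero`, `LiIndexSets.one_lt_norm_inv_one_sub_inv_iff`, `LiIndexSets.re_eq_half_of_abs_im_le`,
`riemannHypothesisUpTo_1000`.
This part (the scratch's local notation `NTZ` is spelled `ZetaZeros.riemannZetaNontrivialZeros`; proofs otherwise verbatim):
* §3 `layer_law`: `¬RH` ⟹ with `r₀ = min_ρ ‖1 − 1/ρ‖ ∈ (0,1)` (attained on the finite EXTREMAL LAYER `E`; `finite_layer`, `exists_gap_radius`)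
  and `u_ρ = r₀(1 − 1/ρ)⁻¹`: `r₀ⁿ λ_n + Σ_{ρ∈E} m(ρ) Re(u_ρⁿ) → 0` (tree `Voros2006_eqDA_holds` at a radius in the modulus gap);
* §4 `li_two_signs_of_not_rh`: `¬RH` ⟹ `|λ_n| ≤ C r₀^{-n}` and, in every window `[N, N+L)` (`N ≥ n₁`), some `λ_n ≥ c r₀^{-n}` and some
  `λ_{n'} ≤ −c r₀^{-n'}` (`c > 0`): the Li sequence lives at the exact scale `r₀^{-n}` with bounded-gap sign changes (Voros's untyped gloss
  «oscillates between exponentially growing values of both signs» made quantitative: SAME rate both sides, SYNDETIC index sets) — via part 1's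
  `window_two_signs`;
* §5a corollaries: `eventually_pos_of_rh`; `liPos_syndetic` — UNCONDITIONALLY `{n : λ_n > 0}` is syndetic; `not_rh_iff_liNeg_syndetic` — the
  `∅ / syndetic` dichotomy for `{n : λ_n < 0}` (no sparse-infinite regime); referee labels per card §12 ((3) RH-FREE DICHOTOMY LAW, (4)
  UNCONDITIONAL THEOREM, (5) RH-EQUIVALENT CRITERION).
HONEST LABEL: «SPLITTING SEARCH over kernel-typed RH-EQUIVALENCES; a splitting A ∧ B ⟹ RH is CONDITIONAL bookkeeping
unless A and B are both proved; nothing here bears on the truth of RH.»  Every theorem below is RH-FREE (an implication /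
dichotomy proved outright) or an RH-EQUIVALENCE.
-/

set_option linter.dupNamespace false

noncomputable section

open Complex Filter Topology Finset Asymptotics
open scoped Real ComplexConjugate

namespace Summit.RiemannHypothesis.RiemannHypothesis.Theorems.Splittings.LiExtremalLayer

open Literature.NumberTheory.LFunctions
open Summit.RiemannHypothesis.RiemannHypothesis.Theorems.Splittings
open Summit.RiemannHypothesis.RiemannHypothesis.Theorems.Splittings.LiIndexSets

/-! ## §3 The extremal layer of off-line zeros and the LAYER LAW (from the tree's Darboux asymptotic `Voros2006_eqDA_holds`) -/

/-- `¬RH` ⟹ some non-trivial zero has `Re ρ > 1/2` (reflection `ρ ↦ 1 − ρ̄`). -/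
theorem exists_offline_zero (h : ¬ _root_.RiemannHypothesis) :
    ∃ ρ : ℂ, ρ ∈ ZetaZeros.riemannZetaNontrivialZeros ∧ 1 / 2 < ρ.re := by
  unfold _root_.RiemannHypothesis at h
  push Not at h
  obtain ⟨s, hs, htriv, -, hre⟩ := h
  have hmem : s ∈ ZetaZeros.riemannZetaNontrivialZeros := ⟨hs, by rintro ⟨k, hk⟩; exact htriv k hk.symm⟩
  rcases lt_or_gt_of_ne hre with hlt | hgt
  · refine ⟨1 - conj s, ZetaZeros.riemannZetaNontrivialZeros.one_sub_conj_mem hmem, ?_⟩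
    simp only [sub_re, one_re, conj_re]
    linarith
  · exact ⟨s, hmem, hgt⟩

/-- `1 − 1/ρ ≠ 0` for a non-trivial zero. -/
theorem one_sub_inv_ne_zero {ρ : ℂ} (hρ : ρ ∈ ZetaZeros.riemannZetaNontrivialZeros) : 1 - 1 / ρ ≠ 0 := by
  intro h
  have h1 : (1 : ℂ) / ρ = 1 := by linear_combination -h
  have hρ1 : ρ = 1 := by
    have h0 : ρ ≠ 0 := FordL33.coe_ne_zero ⟨ρ, hρ⟩
    field_simp at h1
    linear_combination -h1
  exact ZetaZeros.riemannZetaNontrivialZeros.ne_one hρ hρ1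

/-- `Re ρ > 1/2` ⟺ `‖1 − 1/ρ‖ < 1` direction used here. -/
theorem normZ_lt_one {ρ : ℂ} (hρ : ρ ∈ ZetaZeros.riemannZetaNontrivialZeros) (hre : 1 / 2 < ρ.re) : ‖1 - 1 / ρ‖ < 1 := by
  have h := (one_lt_norm_inv_one_sub_inv_iff (ZetaZeros.riemannZetaNontrivialZeros.ne_one hρ)).2 hre
  rw [norm_inv] at h
  have hpos : 0 < ‖1 - 1 / ρ‖ := norm_pos_iff.2 (one_sub_inv_ne_zero hρ)
  exact ((one_lt_inv_iff₀).1 h).2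

/-- If `‖1 − 1/ρ‖ ≤ r < 1` then `‖ρ − 1‖ ≤ r/(1−r)`. -/
theorem norm_sub_one_le_of_normZ_le {ρ : ℂ} (h0 : ρ ≠ 0) {r : ℝ} (hr : r < 1)
    (h : ‖1 - 1 / ρ‖ ≤ r) : ‖ρ - 1‖ ≤ r / (1 - r) := by
  have hr0 : 0 ≤ r := (norm_nonneg _).trans h
  have e : 1 - 1 / ρ = (ρ - 1) / ρ := by field_simp
  rw [e, norm_div, div_le_iff₀ (norm_pos_iff.2 h0)] at h
  have h2 : ‖ρ‖ ≤ ‖ρ - 1‖ + 1 := by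
    calc ‖ρ‖ = ‖(ρ - 1) + 1‖ := by ring_nf
      _ ≤ ‖ρ - 1‖ + ‖(1 : ℂ)‖ := norm_add_le _ _
      _ = ‖ρ - 1‖ + 1 := by rw [norm_one]
  have h3 : ‖ρ - 1‖ * (1 - r) ≤ r := by nlinarith [norm_nonneg (ρ - 1), mul_le_mul_of_nonneg_left h2 hr0]
  rwa [le_div_iff₀ (by linarith)]

/-- The layers `{ρ ∈ ZetaZeros.riemannZetaNontrivialZeros : ‖1 − 1/ρ‖ ≤ r}` are finite for `r < 1` (they sit in the box `|Im ρ| ≤ r/(1−r)`). -/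
theorem finite_layer {r : ℝ} (hr : r < 1) : {ρ : ℂ | ρ ∈ ZetaZeros.riemannZetaNontrivialZeros ∧ ‖1 - 1 / ρ‖ ≤ r}.Finite := by
  refine (liZeroBox_finite (r / (1 - r))).subset ?_
  rintro ρ ⟨hρ, hle⟩
  have h0 : ρ ≠ 0 := FordL33.coe_ne_zero ⟨ρ, hρ⟩
  refine ⟨ZetaZeros.riemannZetaNontrivialZeros.zeta_eq_zero hρ,
    (ZetaZeros.riemannZetaNontrivialZeros.re_pos hρ).le,
    (ZetaZeros.riemannZetaNontrivialZeros.re_lt_one hρ).le,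
    abs_pos.2 (ZetaZeros.riemannZetaNontrivialZeros.im_ne_zero hρ), ?_⟩
  calc |ρ.im| = |(ρ - 1).im| := by simp
    _ ≤ ‖ρ - 1‖ := Complex.abs_im_le_norm _
    _ ≤ r / (1 - r) := norm_sub_one_le_of_normZ_le h0 hr hle

/-- The moduli `‖1 − 1/ρ‖` do not accumulate from above at any `r₀ < 1`: there is `r ∈ (r₀, 1)` with no
modulus in `(r₀, r]`. -/
theorem exists_gap_radius {r₀ : ℝ} (hr₀1 : r₀ < 1) :
    ∃ r : ℝ, r₀ < r ∧ r < 1 ∧ ∀ ρ ∈ ZetaZeros.riemannZetaNontrivialZeros, ‖1 - 1 / ρ‖ ≤ r → ‖1 - 1 / ρ‖ ≤ r₀ := by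
  classical
  have hmid : (r₀ + 1) / 2 < 1 := by linarith
  set T := (finite_layer hmid).toFinset with hT
  let vals : Finset ℝ := insert ((r₀ + 1) / 2)
    ((T.filter fun ρ ↦ r₀ < ‖1 - 1 / ρ‖).image fun ρ ↦ ‖1 - 1 / ρ‖)
  have hne : vals.Nonempty := Finset.insert_nonempty _ _
  set r₁ := vals.min' hne with hr₁
  have hr₁gt : r₀ < r₁ := by
    refine (Finset.lt_min'_iff _ _).2 fun y hy ↦ ?_
    rcases Finset.mem_insert.1 hy with rfl | hy
    · linarith
    · obtain ⟨ρ, hρ, rfl⟩ := Finset.mem_image.1 hy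
      exact (Finset.mem_filter.1 hρ).2
  have hr₁le : r₁ ≤ (r₀ + 1) / 2 := Finset.min'_le _ _ (Finset.mem_insert_self _ _)
  refine ⟨(r₀ + r₁) / 2, by linarith, by linarith, fun ρ hρ hle ↦ ?_⟩
  by_contra hgt
  push Not at hgt
  have hρT : ρ ∈ T := by
    rw [hT, Set.Finite.mem_toFinset]
    exact ⟨hρ, by linarith⟩
  have hmem : ‖1 - 1 / ρ‖ ∈ vals :=
    Finset.mem_insert_of_mem (Finset.mem_image.2 ⟨ρ, Finset.mem_filter.2 ⟨hρT, hgt⟩, rfl⟩)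
  have := Finset.min'_le _ _ hmem
  linarith

/-- `r·(1 − 1/ρ)⁻¹ ≠ 1` for a non-trivial zero and real `r` (else `ρ` would be real). -/
theorem rotate_ne_one {ρ : ℂ} (hρ : ρ ∈ ZetaZeros.riemannZetaNontrivialZeros) (r : ℝ) : (r : ℂ) * (1 - 1 / ρ)⁻¹ ≠ 1 := by
  intro h
  have hz := one_sub_inv_ne_zero hρ
  have h0 : ρ ≠ 0 := FordL33.coe_ne_zero ⟨ρ, hρ⟩
  have h1 : (1 : ℂ) - 1 / ρ = r := by
    have := congrArg (· * (1 - 1 / ρ)) h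
    simp only [inv_mul_cancel_right₀ hz, one_mul] at this
    exact this.symm
  have him : ((1 : ℂ) - 1 / ρ).im = 0 := by rw [h1, Complex.ofReal_im]
  rw [Complex.sub_im, Complex.one_im, one_div, Complex.inv_im, zero_sub, neg_div, neg_neg,
    div_eq_zero_iff] at him
  rcases him with him | him
  · exact ZetaZeros.riemannZetaNontrivialZeros.im_ne_zero hρ him
  · exact h0 (Complex.normSq_eq_zero.1 him)

/-- **LAYER LAW.** If RH fails, let `r₀ = min_ρ ‖1 − 1/ρ‖ ∈ (0, 1)` (attained on the finite, non-empty
EXTREMAL LAYER `E` of off-line zeros) and `u_ρ = r₀ (1 − 1/ρ)⁻¹` (`‖u_ρ‖ = 1`, `u_ρ ≠ 1`).  Then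
`r₀ⁿ λ_n + Σ_{ρ ∈ E} m(ρ) Re(u_ρⁿ) → 0`.  [tree `Voros2006_eqDA_holds` at a radius strictly between `r₀`
and the next modulus] -/
theorem layer_law (hRH : ¬ _root_.RiemannHypothesis) :
    ∃ r₀ : ℝ, 0 < r₀ ∧ r₀ < 1 ∧ ∃ E : Finset ℂ, E.Nonempty ∧
      (∀ ρ ∈ E, ρ ∈ ZetaZeros.riemannZetaNontrivialZeros ∧ ‖1 - 1 / ρ‖ = r₀) ∧
      (∀ ρ ∈ ZetaZeros.riemannZetaNontrivialZeros, r₀ ≤ ‖1 - 1 / ρ‖) ∧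
      Tendsto (fun n : ℕ ↦ r₀ ^ n * keiperLiCoeff n +
        trigSum E (fun ρ ↦ (riemannZetaZeroOrder ρ : ℝ)) (fun ρ ↦ (r₀ : ℂ) * (1 - 1 / ρ)⁻¹) n)
        atTop (𝓝 0) := by
  classical
  obtain ⟨ρ₁, hρ₁, hre₁⟩ := exists_offline_zero hRH
  have hlt₁ := normZ_lt_one hρ₁ hre₁
  set F := (finite_layer hlt₁).toFinset with hF
  have hρ₁F : ρ₁ ∈ F := by
    rw [hF, Set.Finite.mem_toFinset]
    exact ⟨hρ₁, le_rfl⟩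
  obtain ⟨ρ₀, hρ₀F, hmin⟩ := F.exists_min_image (fun ρ ↦ ‖1 - 1 / ρ‖) ⟨ρ₁, hρ₁F⟩
  have hρ₀ : ρ₀ ∈ ZetaZeros.riemannZetaNontrivialZeros ∧ ‖1 - 1 / ρ₀‖ ≤ ‖1 - 1 / ρ₁‖ := by
    rwa [hF, Set.Finite.mem_toFinset] at hρ₀F
  set r₀ := ‖1 - 1 / ρ₀‖ with hr₀
  have hr₀1 : r₀ < 1 := hρ₀.2.trans_lt hlt₁
  have hr₀0 : 0 < r₀ := norm_pos_iff.2 (one_sub_inv_ne_zero hρ₀.1)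
  have hglob : ∀ ρ ∈ ZetaZeros.riemannZetaNontrivialZeros, r₀ ≤ ‖1 - 1 / ρ‖ := by
    intro ρ hρ
    by_cases hle : ‖1 - 1 / ρ‖ ≤ ‖1 - 1 / ρ₁‖
    · exact hmin ρ (by rw [hF, Set.Finite.mem_toFinset]; exact ⟨hρ, hle⟩)
    · exact hρ₀.2.trans (le_of_not_ge hle)
  set E := (finite_layer hr₀1).toFinset with hE
  have hmemE : ∀ ρ, ρ ∈ E ↔ ρ ∈ ZetaZeros.riemannZetaNontrivialZeros ∧ ‖1 - 1 / ρ‖ ≤ r₀ := fun ρ ↦ by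
    rw [hE, Set.Finite.mem_toFinset]; rfl
  obtain ⟨r, hr₀r, hr1, hgap⟩ := exists_gap_radius hr₀1
  have hset : {ρ : ℂ | ρ ∈ ZetaZeros.riemannZetaNontrivialZeros ∧ ‖1 - 1 / ρ‖ ≤ r} = {ρ : ℂ | ρ ∈ ZetaZeros.riemannZetaNontrivialZeros ∧ ‖1 - 1 / ρ‖ ≤ r₀} := by
    ext ρ
    exact ⟨fun h ↦ ⟨h.1, hgap ρ h.1 h.2⟩, fun h ↦ ⟨h.1, h.2.trans hr₀r.le⟩⟩
  have hDA := Voros2006_eqDA_holds r (hr₀0.trans hr₀r) hr1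
  rw [hset] at hDA
  have hDA' : (fun n : ℕ ↦ keiperLiCoeff n +
      ∑ ρ ∈ E, (riemannZetaZeroOrder ρ : ℝ) * (((1 - 1 / ρ)⁻¹) ^ n).re) =o[atTop]
      (fun n : ℕ ↦ r⁻¹ ^ n) :=
    hDA.congr (fun n ↦ by rw [finsum_mem_eq_finite_toFinset_sum _ (finite_layer hr₀1)]) fun _ ↦ rfl
  have h2 := (isBigO_refl (fun n : ℕ ↦ r₀ ^ n) atTop).mul_isLittleO hDA'
  have h3 : Tendsto (fun n : ℕ ↦ r₀ ^ n * r⁻¹ ^ n) atTop (𝓝 0) := by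
    have e : (fun n : ℕ ↦ r₀ ^ n * r⁻¹ ^ n) = fun n ↦ (r₀ * r⁻¹) ^ n := by
      funext n; rw [mul_pow]
    rw [e]
    refine tendsto_pow_atTop_nhds_zero_of_lt_one
      (mul_nonneg hr₀0.le (inv_nonneg.2 (hr₀0.trans hr₀r).le)) ?_
    rw [mul_inv_lt_iff₀ (hr₀0.trans hr₀r), one_mul]
    exact hr₀r
  have h4 := h2.trans_tendsto h3
  refine ⟨r₀, hr₀0, hr₀1, E, ⟨ρ₀, (hmemE ρ₀).2 ⟨hρ₀.1, le_rfl⟩⟩,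
    fun ρ hρ ↦ ⟨((hmemE ρ).1 hρ).1, le_antisymm ((hmemE ρ).1 hρ).2 (hglob ρ ((hmemE ρ).1 hρ).1)⟩,
    hglob, h4.congr fun n ↦ ?_⟩
  simp only [trigSum, mul_add, Finset.mul_sum]
  congr 1
  refine Finset.sum_congr rfl fun ρ _ ↦ ?_
  rw [mul_pow, ← Complex.ofReal_pow, Complex.re_ofReal_mul]
  ring

/-! ## §4 `¬RH` ⟹ `λ_n` lives at the exact scale `r₀^{-n}` with BOUNDED-GAP sign changes -/

/-- **Two-signed exponential oscillation with bounded gaps.**  If RH fails, let `r₀ ∈ (0,1)` be the least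
modulus `‖1 − 1/ρ‖` over the non-trivial zeros (attained).  There are `c > 0`, `C`, a gap bound `L` and `n₁`
with: `|λ_n| ≤ C·r₀^{-n}` for `n ≥ n₁`, and EVERY window `[N, N+L)`, `N ≥ n₁`, contains an `n` with
`λ_n ≥ c·r₀^{-n}` and an `n'` with `λ_{n'} ≤ −c·r₀^{-n'}`. -/
theorem li_two_signs_of_not_rh (hRH : ¬ _root_.RiemannHypothesis) :
    ∃ r₀ : ℝ, 0 < r₀ ∧ r₀ < 1 ∧ (∀ ρ ∈ ZetaZeros.riemannZetaNontrivialZeros, r₀ ≤ ‖1 - 1 / ρ‖) ∧ (∃ ρ ∈ ZetaZeros.riemannZetaNontrivialZeros, ‖1 - 1 / ρ‖ = r₀) ∧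
      ∃ c : ℝ, 0 < c ∧ ∃ C : ℝ, ∃ L n₁ : ℕ,
      (∀ n : ℕ, n₁ ≤ n → |keiperLiCoeff n| ≤ C * r₀⁻¹ ^ n) ∧
      ∀ N : ℕ, n₁ ≤ N →
        (∃ n ∈ Ico N (N + L), c * r₀⁻¹ ^ n ≤ keiperLiCoeff n) ∧
        (∃ n ∈ Ico N (N + L), keiperLiCoeff n ≤ -(c * r₀⁻¹ ^ n)) := by
  obtain ⟨r₀, hr₀0, hr₀1, E, hE, hEmem, hglob, hlim⟩ := layer_law hRH
  set m : ℂ → ℝ := fun ρ ↦ (riemannZetaZeroOrder ρ : ℝ) with hm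
  set u : ℂ → ℂ := fun ρ ↦ (r₀ : ℂ) * (1 - 1 / ρ)⁻¹ with hu
  have hmpos : ∀ ρ ∈ E, 0 < m ρ := fun ρ hρ ↦ FordL33.order_pos ⟨ρ, (hEmem ρ hρ).1⟩
  have hunit : ∀ ρ ∈ E, ‖u ρ‖ = 1 := by
    intro ρ hρ
    simp only [hu, norm_mul, Complex.norm_real, Real.norm_eq_abs, abs_of_pos hr₀0, norm_inv,
      (hEmem ρ hρ).2]
    exact mul_inv_cancel₀ hr₀0.ne'
  have hne1 : ∀ ρ ∈ E, u ρ ≠ 1 := fun ρ hρ ↦ rotate_ne_one (hEmem ρ hρ).1 r₀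
  have hη0 : 0 < margin E m := margin_pos hE hmpos
  obtain ⟨n₁, hn₁⟩ := Metric.tendsto_atTop.1 hlim (margin E m / 2) (by positivity)
  have hbd : ∀ n, n₁ ≤ n → |r₀ ^ n * keiperLiCoeff n + trigSum E m u n| < margin E m / 2 := by
    intro n hn
    have := hn₁ n hn
    rwa [Real.dist_0_eq_abs] at this
  have hpow : ∀ n : ℕ, r₀⁻¹ ^ n * r₀ ^ n = 1 := fun n ↦ by
    rw [← mul_pow, inv_mul_cancel₀ hr₀0.ne', one_pow]
  have hpowpos : ∀ n : ℕ, 0 < r₀⁻¹ ^ n := fun n ↦ pow_pos (inv_pos.2 hr₀0) n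
  obtain ⟨ρ₀, hρ₀⟩ := hE
  refine ⟨r₀, hr₀0, hr₀1, hglob, ⟨ρ₀, (hEmem ρ₀ hρ₀).1, (hEmem ρ₀ hρ₀).2⟩, margin E m / 2,
    by positivity, mass E m + margin E m / 2, windowLen E m u, n₁, fun n hn ↦ ?_,
    fun N hN ↦ ⟨?_, ?_⟩⟩
  · have h1 := abs_lt.1 (hbd n hn)
    have h2 := abs_le.1 (abs_trigSum_le (fun ρ hρ ↦ (hmpos ρ hρ).le) hunit n)
    have h3 : |r₀ ^ n * keiperLiCoeff n| ≤ mass E m + margin E m / 2 :=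
      abs_le.2 ⟨by linarith [h1.1, h2.2], by linarith [h1.2, h2.1]⟩
    calc |keiperLiCoeff n| = r₀⁻¹ ^ n * |r₀ ^ n * keiperLiCoeff n| := by
          rw [abs_mul, abs_of_pos (pow_pos hr₀0 n), ← mul_assoc, hpow, one_mul]
      _ ≤ r₀⁻¹ ^ n * (mass E m + margin E m / 2) := mul_le_mul_of_nonneg_left h3 (hpowpos n).le
      _ = (mass E m + margin E m / 2) * r₀⁻¹ ^ n := mul_comm _ _
  · obtain ⟨n, hn, hle⟩ := (window_two_signs ⟨ρ₀, hρ₀⟩ hmpos hunit hne1 N).2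
    refine ⟨n, hn, ?_⟩
    have hn₁n : n₁ ≤ n := hN.trans (Finset.mem_Ico.1 hn).1
    have h1 := (abs_lt.1 (hbd n hn₁n)).1
    have h2 : margin E m / 2 ≤ r₀ ^ n * keiperLiCoeff n := by linarith
    calc margin E m / 2 * r₀⁻¹ ^ n ≤ (r₀ ^ n * keiperLiCoeff n) * r₀⁻¹ ^ n :=
          mul_le_mul_of_nonneg_right h2 (hpowpos n).le
      _ = keiperLiCoeff n := by rw [mul_comm, ← mul_assoc, hpow, one_mul]
  · obtain ⟨n, hn, hge⟩ := (window_two_signs ⟨ρ₀, hρ₀⟩ hmpos hunit hne1 N).1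
    refine ⟨n, hn, ?_⟩
    have hn₁n : n₁ ≤ n := hN.trans (Finset.mem_Ico.1 hn).1
    have h1 := (abs_lt.1 (hbd n hn₁n)).2
    have h2 : r₀ ^ n * keiperLiCoeff n ≤ -(margin E m / 2) := by linarith
    have h3 := mul_le_mul_of_nonneg_right h2 (hpowpos n).le
    rw [mul_comm, ← mul_assoc, hpow, one_mul] at h3
    linarith

/-! ## §5a Corollaries: positivity on a syndetic set (unconditional); the `∅ / syndetic` dichotomy for `λ_n < 0` -/

/-- Under RH, eventually `λ_n > 0` (indeed `λ_n ≥ n/2` for `n ≥ 2¹⁴` beyond the `o(n)` threshold), from the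
tree's `Voros2006_thm_onlyif_holds` (`λ_n = ½ n (log n − 1 + γ − log 2π) + o(n)`). -/
theorem eventually_pos_of_rh (hRH : _root_.RiemannHypothesis) :
    ∃ n₀ : ℕ, ∀ n : ℕ, n₀ ≤ n → 0 < keiperLiCoeff n := by
  have h := (Voros2006_thm_onlyif_holds hRH).def (show (0 : ℝ) < 1 / 2 by norm_num)
  obtain ⟨N, hN⟩ := eventually_atTop.1 (h.and (eventually_ge_atTop (2 ^ 14)))
  refine ⟨N, fun n hn ↦ ?_⟩
  obtain ⟨hb, hn14⟩ := hN n hn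
  have hn14' : (2 : ℝ) ^ 14 ≤ n := by exact_mod_cast hn14
  have hlog2 : (0.6931471803 : ℝ) < Real.log 2 := Real.log_two_gt_d9
  have hlogn : Real.log ((2 : ℝ) ^ 14) ≤ Real.log n := Real.log_le_log (by positivity) hn14'
  rw [Real.log_pow] at hlogn
  push_cast at hlogn
  have hγ : (1 : ℝ) / 2 < Real.eulerMascheroniConstant := Real.one_half_lt_eulerMascheroniConstant
  have hlog2π : Real.log (2 * Real.pi) ≤ 2 * Real.pi - 1 := Real.log_le_sub_one_of_pos (by positivity)
  have hπ : Real.pi ≤ 4 := Real.pi_le_four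
  have hbr : 2 ≤ Real.log n - 1 + Real.eulerMascheroniConstant - Real.log (2 * Real.pi) := by linarith
  rw [Real.norm_eq_abs, Real.norm_eq_abs, Nat.abs_cast] at hb
  have h1 := (abs_le.1 hb).1
  have hn0 : (0 : ℝ) ≤ n := Nat.cast_nonneg n
  have hmain : (n : ℝ) ≤ (n : ℝ) / 2 *
      (Real.log n - 1 + Real.eulerMascheroniConstant - Real.log (2 * Real.pi)) := by nlinarith
  have hnpos : (0 : ℝ) < n := lt_of_lt_of_le (by positivity) hn14'
  linarith

/-- **UNCONDITIONAL: `λ_n > 0` on a syndetic set** — every window `[N, N+L)` of a fixed length contains an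
`n` with `λ_n > 0` (under RH all large `λ_n` are positive; under `¬RH` by the two-signed oscillation). -/
theorem liPos_syndetic : ∃ L : ℕ, ∀ N : ℕ, ∃ n ∈ Ico N (N + L), 0 < keiperLiCoeff n := by
  by_cases hRH : _root_.RiemannHypothesis
  · obtain ⟨n₀, hn₀⟩ := eventually_pos_of_rh hRH
    refine ⟨n₀ + 1, fun N ↦ ⟨max N n₀, Finset.mem_Ico.2 ⟨le_max_left _ _, ?_⟩, hn₀ _ (le_max_right _ _)⟩⟩
    omega
  · obtain ⟨r₀, hr₀0, -, -, -, c, hc, -, L, n₁, -, hwin⟩ := li_two_signs_of_not_rh hRH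
    refine ⟨L + n₁, fun N ↦ ?_⟩
    obtain ⟨n, hn, hle⟩ := (hwin (max N n₁) (le_max_right _ _)).1
    rw [Finset.mem_Ico] at hn
    refine ⟨n, Finset.mem_Ico.2 ⟨(le_max_left _ _).trans hn.1, ?_⟩,
      lt_of_lt_of_le (mul_pos hc (pow_pos (inv_pos.2 hr₀0) n)) hle⟩
    have := le_max_left N n₁
    have := max_le (Nat.le_add_right N n₁) (Nat.le_add_left n₁ N)
    omega

/-- **The `∅ / syndetic` dichotomy**: `¬RH ⟺ {n : λ_n < 0}` is syndetic (and under RH it is empty beyond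
`n = 0` by Li's criterion) — there is no intermediate regime (e.g. `λ_n < 0` on a sparse infinite set). -/
theorem not_rh_iff_liNeg_syndetic :
    ¬ _root_.RiemannHypothesis ↔ ∃ L : ℕ, ∀ N : ℕ, ∃ n ∈ Ico N (N + L), keiperLiCoeff n < 0 := by
  constructor
  · intro hRH
    obtain ⟨r₀, hr₀0, -, -, -, c, hc, -, L, n₁, -, hwin⟩ := li_two_signs_of_not_rh hRH
    refine ⟨L + n₁, fun N ↦ ?_⟩
    obtain ⟨n, hn, hle⟩ := (hwin (max N n₁) (le_max_right _ _)).2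
    rw [Finset.mem_Ico] at hn
    refine ⟨n, Finset.mem_Ico.2 ⟨(le_max_left _ _).trans hn.1, ?_⟩,
      lt_of_le_of_lt hle (neg_neg_of_pos (mul_pos hc (pow_pos (inv_pos.2 hr₀0) n)))⟩
    have := max_le (Nat.le_add_right N n₁) (Nat.le_add_left n₁ N)
    omega
  · rintro ⟨L, hL⟩ hRH
    obtain ⟨n, hn, hlt⟩ := hL 1
    have h1 : 1 ≤ n := (Finset.mem_Ico.1 hn).1
    have := (li_criterion_holds.1 hRH) n h1
    linarith

end Summit.RiemannHypothesis.RiemannHypothesis.Theorems.Splittings.LiExtremalLayer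

end
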